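import Summits.NavierStokesRegularity.FluidComputer.LipRowInequality
import Summits.NavierStokesRegularity.FluidComputer.PowerComparison
import HarnessLib

/-!
# Fluid computer — L61: THE `Ḃ^{5/2}_{2,1}` ROW ITSELF obeys the optimal inviscid clock
# `∑_l 2^{5l/2} ‖Δ̇_l u(t)‖₂ ≥ c/(T − t)` with an ABSOLUTE constant (McCormick et al. 2016, dyadic currency)

HONEST FRAMING (cell `pub-fluidc`, verbatim): *low prior, high value-of-information experiment on Tao's
machine paradigm; NOT a claim that NS blows up.* Theorem side of the cell (the level dictionary); nothing here is
evidence of blow-up — necessities for EVERY maximal smooth finite-energy solution on `ℝ³`.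

The `Ḃ^{5/2}_{2,1}` row `P(t) = ∑_l 2^{5l/2} a_l(t)` (the tree's `ℓ¹` ladder currency of L51, at the Lipschitz level: it
dominates `∑_l 2^l‖Δ̇_l u‖_∞ ≳ ‖∇u‖_∞`) satisfies the ν-free, energy-free law `P(t) − P(s) ≤ K∫_s^t P²`
(`LipRowInequality.lipRow_two_point`), whence

* `exists_lipRow_gt` — `P` is unbounded on every terminal window (`Y_5 ≤ P²`, `HighRows.exists_row_gt`);
* `lipRow_clock` (**L61**) — an ABSOLUTE `c > 0` with **`c · (T − t)^{−1} ≤ ∑_l 2^{5l/2} ‖Δ̇_l u(t)‖₂`** at EVERY `t ∈ (0, T)`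
  (comparison `PowerComparison.rpow_mul_le_of_rpow` with `q = 1` on `P(t + ·) + ε`); `lipRow_tendsto_top`;
  `lipRow_clock_of_cascadeWitness` — the interface reading.

This is McCormick–Olson–Robinson–Rodrigo–Vidal-López–Zhou's `‖u(t)‖_{Ḃ^{5/2}_{2,1}} ≳ (T − t)^{−1}` (2016, Thm. 1.1) in the
tree's dyadic currency: the SCALING-SHARP rate at the Lipschitz level, constant free of `ν` AND of the energy; it implies
L60 (`(∑2^{5l/2}a_l)⁴ ≲ Y_{5−δ}Y_{5+δ}`) and the `s = 5/2` endpoint the ladder L51–L58 could not reach. HONEST: constant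
inexplicit; class = NS maximal smooth LH solutions on `ℝ³`; Euler-class version not landed. 0 sorry; no definitions; no
named facts.

## References

* D. S. McCormick, E. J. Olson, J. C. Robinson, J. L. Rodrigo, A. Vidal-López, Y. Zhou, SIAM J. Math. Anal. 48 (2016)
  2119–2132, Thm. 1.1. [MccormickEtAl2016]
* J. T. Beale, T. Kato, A. Majda, Comm. Math. Phys. 94 (1984) 61–66 (the Lipschitz level). [BealeKatoMajda1984]
-/

noncomputable section

open MeasureTheory Set Function Filter Topology
open scoped ENNReal NNReal
open Literature.Analysis.FluidPDE Literature.Analysis.FunctionSpaces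
open Literature.Analysis.FluidPDE.FluidComputer
open Summit.NavierStokesRegularity.NavierStokesRegularity.Theorems.FluidComputer (x5a_of_cascadeWitness')
open Summit.NavierStokesRegularity.FluidComputer.BlockEnergyTransport
open Summit.NavierStokesRegularity.FluidComputer.LipRowInequality
open Summit.NavierStokesRegularity.FluidComputer.LipRowContinuity
open Summit.NavierStokesRegularity.FluidComputer.PowerComparison

namespace Summit.NavierStokesRegularity.FluidComputer.LipRowClock

/-! ## Finiteness and divergence of the `Ḃ^{5/2}_{2,1}` row -/

/-- The `Ḃ^{5/2}_{2,1}` row is finite on the open lifespan. [folklore] -/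
theorem lipRow_ne_top {ν T : ℝ} (hν : 0 < ν) (hT : 0 < T)
    {u : ℝ → EuclideanSpace ℝ (Fin 3) → EuclideanSpace ℝ (Fin 3)} {p : ℝ → EuclideanSpace ℝ (Fin 3) → ℝ}
    (hmax : IsMaximalSmoothSolution ν 0 u p T) (hLH : IsLerayHopfOn T ν 0 (u 0) u) {τ : ℝ} (hτ : τ ∈ Ioo 0 T) :
    ∑' l : ℤ, (2 : ℝ≥0∞) ^ ((5 / 2 : ℝ) * (l : ℝ)) * blockL2 (u τ) l ≠ ∞ := by
  obtain ⟨B, -, hB⟩ := exists_lipRow_envelope hν hT hmax hLH hτ.1 le_rfl hτ.2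
  exact (hB τ ⟨le_rfl, le_rfl⟩).2.1

/-- `Y_5 ≤ P²`: `∑_l 2^{5l} a_l² ≤ (∑_l 2^{5l/2} a_l)²`. [folklore] -/
theorem row5_le_lipRow_sq (a : ℤ → ℝ≥0∞) :
    ∑' l : ℤ, (2 : ℝ≥0∞) ^ ((5 : ℝ) * (l : ℝ)) * a l ^ 2 ≤ (∑' l : ℤ, (2 : ℝ≥0∞) ^ ((5 / 2 : ℝ) * (l : ℝ)) * a l) ^ 2 := by
  set x : ℤ → ℝ≥0∞ := fun l => (2 : ℝ≥0∞) ^ ((5 / 2 : ℝ) * (l : ℝ)) * a l with hx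
  have h := RiccatiSummationGen.tsum_half_sq 5 a
  rw [← h]
  calc ∑' l : ℤ, ((2 : ℝ≥0∞) ^ ((5 : ℝ) / 2 * (l : ℝ)) * a l) ^ 2 = ∑' l : ℤ, x l * x l :=
        tsum_congr fun l => by rw [hx, sq]
    _ ≤ ∑' l : ℤ, x l * ∑' k : ℤ, x k := ENNReal.tsum_le_tsum fun l => mul_le_mul' le_rfl (ENNReal.le_tsum l)
    _ = (∑' l : ℤ, x l) * ∑' k : ℤ, x k := ENNReal.tsum_mul_right
    _ = (∑' l : ℤ, x l) ^ 2 := (sq _).symm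

/-- **The `Ḃ^{5/2}_{2,1}` row is unbounded on every terminal window**: for `t₀ < T` and every real `M` there is
`b ∈ (t₀, T) ∩ (0, T)` with `M < P(b)` (`Y_5 ≤ P²` and `Y_5 → ∞`, `HighRows.exists_row_gt`). [folklore] -/
theorem exists_lipRow_gt {ν T : ℝ} (hν : 0 < ν) (hT : 0 < T)
    {u : ℝ → EuclideanSpace ℝ (Fin 3) → EuclideanSpace ℝ (Fin 3)} {p : ℝ → EuclideanSpace ℝ (Fin 3) → ℝ}
    (hmax : IsMaximalSmoothSolution ν 0 u p T) (hLH : IsLerayHopfOn T ν 0 (u 0) u)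
    {t₀ : ℝ} (ht₀ : t₀ < T) (M : ℝ) :
    ∃ b ∈ Ioo (max t₀ 0) T, M < (∑' l : ℤ, (2 : ℝ≥0∞) ^ ((5 / 2 : ℝ) * (l : ℝ)) * blockL2 (u b) l).toReal := by
  obtain ⟨b, hb, hMb⟩ := HighRows.exists_row_gt (κ := 5) (by norm_num) hν hT hmax hLH ht₀ (max M 0 ^ 2)
  refine ⟨b, hb, ?_⟩
  have hbI : b ∈ Ioo 0 T := ⟨(le_max_right _ _).trans_lt hb.1, hb.2⟩
  have hPtop := lipRow_ne_top hν hT hmax hLH hbI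
  have hY := row5_le_lipRow_sq (blockL2 (u b))
  have hY' := ENNReal.toReal_mono (ENNReal.pow_ne_top hPtop) hY
  rw [ENNReal.toReal_pow] at hY'
  have h1 : max M 0 ^ 2 < (∑' l : ℤ, (2 : ℝ≥0∞) ^ ((5 / 2 : ℝ) * (l : ℝ)) * blockL2 (u b) l).toReal ^ 2 :=
    hMb.trans_le hY'
  have h3 : max M 0 < (∑' l : ℤ, (2 : ℝ≥0∞) ^ ((5 / 2 : ℝ) * (l : ℝ)) * blockL2 (u b) l).toReal :=
    lt_of_pow_lt_pow_left₀ 2 ENNReal.toReal_nonneg h1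
  exact (le_max_left M 0).trans_lt h3

/-! ## L61: the clock of the `Ḃ^{5/2}_{2,1}` row -/

/-- **L61 — THE `Ḃ^{5/2}_{2,1}` ROW OBEYS THE OPTIMAL INVISCID CLOCK.** There is an ABSOLUTE `c > 0` such that for every
`ν > 0`, `T > 0`, every maximal smooth solution `(u, p)` of the unforced Navier–Stokes system on `ℝ³ × [0, T)` which is
Leray–Hopf from `u 0`, and EVERY `t ∈ (0, T)`:
`c · (T − t)^{−1} ≤ ∑_{l∈ℤ} 2^{5l/2} ‖Δ̇_l u(t)‖₂`
— McCormick et al.'s `‖u(t)‖_{Ḃ^{5/2}_{2,1}} ≳ (T − t)^{−1}` in the tree's dyadic currency: rate SCALING-SHARP at the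
Lipschitz level, constant free of `ν` and of the energy. Proof: the law `P(b) − P(t) ≤ K∫_t^bP²` (`lipRow_two_point`),
the comparison `rpow_mul_le_of_rpow` (`q = 1`) on `P(t + ·) + ε`, the divergence `exists_lipRow_gt`. Necessity only.
[cite: MccormickEtAl2016, Thm. 1.1] [cite: BealeKatoMajda1984, Thm. 1] -/
theorem lipRow_clock :
    ∃ c : ℝ, 0 < c ∧ ∀ (ν T : ℝ), 0 < ν → 0 < T →
      ∀ (u : ℝ → EuclideanSpace ℝ (Fin 3) → EuclideanSpace ℝ (Fin 3)) (p : ℝ → EuclideanSpace ℝ (Fin 3) → ℝ),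
      IsMaximalSmoothSolution ν 0 u p T → IsLerayHopfOn T ν 0 (u 0) u →
      ∀ t ∈ Ioo 0 T,
        ENNReal.ofReal (c * (T - t) ^ (-(1 : ℝ))) ≤
          ∑' l : ℤ, (2 : ℝ≥0∞) ^ ((5 / 2 : ℝ) * (l : ℝ)) * blockL2 (u t) l := by
  obtain ⟨K, hK, hRic⟩ := lipRow_two_point
  refine ⟨K⁻¹, by positivity, fun ν T hν hT u p hmax hLH t₀ ht₀ => ?_⟩
  set Y : ℝ → ℝ := fun τ => (∑' l : ℤ, (2 : ℝ≥0∞) ^ ((5 / 2 : ℝ) * (l : ℝ)) * blockL2 (u τ) l).toReal with hY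
  have hY0 : ∀ τ, 0 ≤ Y τ := fun τ => ENNReal.toReal_nonneg
  have hTt : 0 < T - t₀ := sub_pos.2 ht₀.2
  have hpw : ∀ x : ℝ, x ^ ((1 : ℝ) + 1) = x ^ 2 := fun x => by
    rw [show ((1 : ℝ) + 1) = ((2 : ℕ) : ℝ) by norm_num, Real.rpow_natCast]
  -- the key claim: for every `ε > 0`, `1 ≤ K (Y t₀ + ε) (T - t₀)`
  have hclaim : ∀ ε : ℝ, 0 < ε → 1 ≤ K * (Y t₀ + ε) * (T - t₀) := by
    intro ε hε
    by_contra hlt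
    push Not at hlt
    set A : ℝ := Y t₀ + ε with hA
    have hA0 : 0 < A := by have := hY0 t₀; linarith
    set θ : ℝ := 1 - K * A * (T - t₀) with hθ
    have hθ0 : 0 < θ := by linarith
    obtain ⟨b, hb, hMb⟩ := exists_lipRow_gt hν hT hmax hLH ht₀.2 (A / θ)
    have hb1 : t₀ < b := (le_max_left t₀ 0).trans_lt hb.1
    have hbT : b < T := hb.2
    have hYc : ContinuousOn Y (Icc t₀ b) := continuousOn_lipRow hν hT hmax hLH ht₀.1 hb1.le hbT
    set G : ℝ → ℝ := fun τ => Y (t₀ + τ) + ε with hG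
    have hmaps : MapsTo (fun τ : ℝ => t₀ + τ) (Icc 0 (b - t₀)) (Icc t₀ b) := fun τ hτ =>
      ⟨by linarith [hτ.1], by linarith [hτ.2]⟩
    have hGc : ContinuousOn G (Icc 0 (b - t₀)) :=
      ((hYc.comp (continuous_const.add continuous_id).continuousOn hmaps).add continuousOn_const)
    have hG0 : ∀ τ ∈ Icc 0 (b - t₀), 0 ≤ G τ := fun τ _ => by have := hY0 (t₀ + τ); simp only [hG]; linarith
    have hpos : 0 < G 0 := by simp only [hG, add_zero]; exact hA0
    have hGpc : ∀ b' ∈ Icc 0 (b - t₀), ContinuousOn (fun τ => G τ ^ 2) (uIcc 0 b') := fun b' hb' => by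
      rw [uIcc_of_le hb'.1]
      exact (hGc.mono (Icc_subset_Icc le_rfl hb'.2)).pow 2
    have hYpc : ∀ b' ∈ Icc 0 (b - t₀), ContinuousOn (fun τ => Y (t₀ + τ) ^ 2) (uIcc 0 b') := fun b' hb' => by
      rw [uIcc_of_le hb'.1]
      exact ((hYc.comp (continuous_const.add continuous_id).continuousOn hmaps).mono
        (Icc_subset_Icc le_rfl hb'.2)).pow 2
    have hineq : ∀ b' ∈ Icc 0 (b - t₀), G b' ≤ G 0 + K * ∫ τ in (0 : ℝ)..b', G τ ^ ((1 : ℝ) + 1) := by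
      intro b' hb'
      simp_rw [hpw]
      have h2 := hRic ν T hν hT u p hmax hLH t₀ (t₀ + b') ht₀.1 (by linarith [hb'.1]) (by linarith [hb'.2])
      have hshift : ∫ τ in t₀..(t₀ + b'), Y τ ^ 2 = ∫ τ in (0 : ℝ)..b', Y (t₀ + τ) ^ 2 := by
        rw [intervalIntegral.integral_comp_add_left (fun τ => Y τ ^ 2) t₀, add_zero]
      have hmono : ∫ τ in (0 : ℝ)..b', Y (t₀ + τ) ^ 2 ≤ ∫ τ in (0 : ℝ)..b', G τ ^ 2 := by
        refine intervalIntegral.integral_mono_on hb'.1 (hYpc b' hb').intervalIntegrable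
          (hGpc b' hb').intervalIntegrable fun τ _ => ?_
        exact pow_le_pow_left₀ (hY0 _) (by simp only [hG]; linarith) 2
      have h3 : Y (t₀ + b') - Y t₀ ≤ K * ∫ τ in (0 : ℝ)..b', G τ ^ 2 := by
        calc Y (t₀ + b') - Y t₀ ≤ K * ∫ τ in t₀..(t₀ + b'), Y τ ^ 2 := h2
          _ ≤ K * ∫ τ in (0 : ℝ)..b', G τ ^ 2 := by
              rw [hshift]; exact mul_le_mul_of_nonneg_left hmono hK.le
      simp only [hG, add_zero]
      linarith
    have hcomp := rpow_mul_le_of_rpow hK.le (by linarith : 0 < b - t₀) one_pos hGc hG0 hpos hineq (b - t₀)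
      ⟨by linarith, le_rfl⟩
    simp only [hG, add_zero, add_sub_cancel, Real.rpow_one, one_mul] at hcomp
    -- `hcomp : (Y b + ε) * (1 - K * (Y t₀ + ε) * (b - t₀)) ≤ Y t₀ + ε`
    have hφ : θ ≤ 1 - K * (Y t₀ + ε) * (b - t₀) := by
      have : K * A * (b - t₀) ≤ K * A * (T - t₀) := mul_le_mul_of_nonneg_left (by linarith) (by positivity)
      rw [hθ, hA]; linarith
    have hYbε : 0 ≤ Y b + ε := by linarith [hY0 b]
    have h4 : (Y b + ε) * θ ≤ A := by
      calc (Y b + ε) * θ ≤ (Y b + ε) * (1 - K * (Y t₀ + ε) * (b - t₀)) := mul_le_mul_of_nonneg_left hφ hYbε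
        _ ≤ Y t₀ + ε := hcomp
        _ = A := rfl
    have h5 : Y b + ε ≤ A / θ := (le_div_iff₀ hθ0).2 h4
    linarith
  -- let `ε → 0`
  have hmain : 1 ≤ K * Y t₀ * (T - t₀) := by
    by_contra hlt
    push Not at hlt
    have hcont : Continuous (fun ε : ℝ => K * (Y t₀ + ε) * (T - t₀)) := by continuity
    have hev : ∀ᶠ ε in 𝓝[>] (0 : ℝ), K * (Y t₀ + ε) * (T - t₀) < 1 := by
      have h := (tendsto_order.1 (hcont.continuousAt (x := (0 : ℝ))).tendsto).2 1 (by simpa only [add_zero] using hlt)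
      exact h.filter_mono nhdsWithin_le_nhds
    obtain ⟨ε, hε, hεpos⟩ := (hev.and self_mem_nhdsWithin).exists
    exact absurd (hclaim ε hεpos) (not_le.2 hε)
  -- conclude: `Y t₀ ≥ 1/(K (T − t₀))`
  have hYt : K⁻¹ * (T - t₀) ^ (-(1 : ℝ)) ≤ Y t₀ := by
    rw [Real.rpow_neg_one, ← mul_inv, inv_le_iff_one_le_mul₀ (by positivity)]
    linarith
  calc ENNReal.ofReal (K⁻¹ * (T - t₀) ^ (-(1 : ℝ))) ≤ ENNReal.ofReal (Y t₀) := ENNReal.ofReal_le_ofReal hYt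
    _ = _ := ENNReal.ofReal_toReal (lipRow_ne_top hν hT hmax hLH ht₀)

/-- **L61′ — the `Ḃ^{5/2}_{2,1}` row tends to `∞` at the optimal rate** as `t ↑ T`. [cite: MccormickEtAl2016, Thm. 1.1] -/
theorem lipRow_tendsto_top {ν T : ℝ} (hν : 0 < ν) (hT : 0 < T)
    {u : ℝ → EuclideanSpace ℝ (Fin 3) → EuclideanSpace ℝ (Fin 3)} {p : ℝ → EuclideanSpace ℝ (Fin 3) → ℝ}
    (hmax : IsMaximalSmoothSolution ν 0 u p T) (hLH : IsLerayHopfOn T ν 0 (u 0) u) :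
    Tendsto (fun t => ∑' l : ℤ, (2 : ℝ≥0∞) ^ ((5 / 2 : ℝ) * (l : ℝ)) * blockL2 (u t) l) (𝓝[<] T) (𝓝 ∞) := by
  obtain ⟨c, hc, H⟩ := lipRow_clock
  have h := SobolevLadderFront.tendsto_ofReal_clock_top (a := (0 : ℝ)) (b := (1 : ℝ)) (T := T) hc hν one_pos
  refine tendsto_nhds_top_mono h ?_
  filter_upwards [Ioo_mem_nhdsLT hT] with t ht
  have h1 := H ν T hν hT u p hmax hLH t ht
  simpa only [Real.rpow_zero, mul_one] using h1

/-- **L61 READ ON THE INTERFACE: every cascade witness obeys the `Ḃ^{5/2}_{2,1}` clock.** Every `W : CascadeWitness`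
yields `ν > 0`, `T > 0` and a maximal smooth solution `(u, p)` of the unforced Navier–Stokes system on `ℝ³ × [0, T)`,
Leray–Hopf from `u 0` (`x5a_of_cascadeWitness'`), such that with the ABSOLUTE constant `c` of `lipRow_clock`:
`c (T − t)^{−1} ≤ ∑_l 2^{5l/2}‖Δ̇_l u(t)‖₂` at every `t ∈ (0, T)` — whatever the witness's viscosity or energy.
[cite: MccormickEtAl2016, Thm. 1.1] -/
theorem lipRow_clock_of_cascadeWitness (W : CascadeWitness) :
    ∃ ν : ℝ, 0 < ν ∧ ∃ T : ℝ, 0 < T ∧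
      ∃ (u : ℝ → EuclideanSpace ℝ (Fin 3) → EuclideanSpace ℝ (Fin 3)) (p : ℝ → EuclideanSpace ℝ (Fin 3) → ℝ),
        IsMaximalSmoothSolution ν 0 u p T ∧ IsLerayHopfOn T ν 0 (u 0) u ∧
        (∀ t ∈ Ioo 0 T,
          ENNReal.ofReal (lipRow_clock.choose * (T - t) ^ (-(1 : ℝ))) ≤
            ∑' l : ℤ, (2 : ℝ≥0∞) ^ ((5 / 2 : ℝ) * (l : ℝ)) * blockL2 (u t) l) ∧
        Tendsto (fun t => ∑' l : ℤ, (2 : ℝ≥0∞) ^ ((5 / 2 : ℝ) * (l : ℝ)) * blockL2 (u t) l) (𝓝[<] T) (𝓝 ∞) := by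
  obtain ⟨ν, hν, T, hT, u, p, hmax, hLH, -⟩ := x5a_of_cascadeWitness' W
  exact ⟨ν, hν, T, hT, u, p, hmax, hLH, lipRow_clock.choose_spec.2 ν T hν hT u p hmax hLH,
    lipRow_tendsto_top hν hT hmax hLH⟩

end Summit.NavierStokesRegularity.FluidComputer.LipRowClock

end
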